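import Summits.QuantumFields.BalabanUV.Beta.GAN24.S3DiffL
import Summits.QuantumFields.BalabanUV.Beta.GAN24.S3DiffLAlignedAt

/-!
# `BalabanUV.Beta.GAN24.S3DiffLAt` — binder row G-an2-4 / (CONV-C), S-slot, road «S3-Taylor», DIFF row R3-dL AT THE IN-BLOCK ROOT `r`, part 3 (END):
# **`diffL_three_at`** — for every in-block root `r ∈ box (3+1) Lc`, every `m < n`, the depth-paired difference of the ROOTED Λ increments (member `n+3`,
# level `m+2` vs member `n+2`, level `m+1`; `lagrIncAt 3 (toSite r) Lc`) is `≤ eL·θ^{n+1}·ρ^{n−m}` entrywise with ONE `(eL, θ, ρ)` FOR ALL ROOTS (twin of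
# `S3DiffL.diffL_three`, leaf-11 g15)

NOT IN PRINT; OUR PROOF ATTEMPT (of the base row; THIS file is [folklore] bookkeeping).  HONEST FRAMING (cell contract, verbatim): «discharging `BetaPertH`
makes Bałaban's UV stability UNCONDITIONAL — a real constructive-QFT result; it is NOT the continuum limit and NOT the Clay problem.»  HONEST DEPENDENCY
(verbatim): «continuum YM on T⁴ ⇐ BetaPertH ∧ nine spine estimates (0/9 proved); BetaPertH ⇐ (D1) ∧ (D4) ∧ CAP+tail; G-an2-4 gates asym, D1 and NE2/3/4.»
The proofs of the base module VERBATIM with `lagrIncAt d (toSite r) Lc` in place of `lagrInc d Lc` (the Hessian enters only through parts 1–2: `TaylorDiffLamAt`,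
`S3DiffLAlignedAt`, and (ρ-c)'s `TaylorRowLamAt.piece_eq_pref_mul_sandwich`); root-free BY NAME: `S3DiffL.phiDiff_of_cauchyDecayK`, the owner's
`StencilSlotE3HLeg.legs_three` ∕ `StencilSlotE3PhiLeg.phiLeg_three` ∕ `KSlotAssembly.convCKWall_holds`, «(N1-Cauchy)» `FineReadoutCauchyHolds.exists_wH_cellMean_cauchy`
through `FineReadoutCauchyDecLegs.decLegs_three_of_cellMean`, `SandwichDecimate.abs_decLeg_le(')`; the row constant `eL` is ROOT-FREE (table mass and supports are
the corner root's, (ρ-a) ∕ (ρ-c)), so it is written BEFORE `∀ r`.  No cited fact, no `def`, no `Prop` mirror, 0 sorry; nothing of the base module is edited.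
Discharges NOTHING of (hS, hSall) ∕ hBdev by itself: it is the births-`≥ 1`, lengths-`≥ 2` UNDRESSED instance of the pair letter of `BornLambdaDriftSup.exists_hBdevLam_three_of_supPairs`
up to the owner's Q22 exponent identity (`BornLambdaUndressedRow.lineage_succ_pin_apply` at both members) — that junction and the CONTACT pairs are NOT here;
NEVER «G-an2-4 closed»; NOT (CONV-C) as typed, NOT D1, NOT BetaPertH, NOT continuum, NOT Clay.  «ROOTED-S3-Λ-DIFF», `b2b-balaban-gan24-formalise-leaf-06` gen 41.
-/

noncomputable section

open Finset
open scoped BigOperators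
open Literature.MathematicalPhysics.QuantumFieldTheory
open Literature.MathematicalPhysics.QuantumFieldTheory.Balaban1983to89
open Literature.MathematicalPhysics.QuantumFieldTheory.Balaban1983to89.Beta
open Literature.Probability.LatticeModels (Torus.proj Torus.proj_apply)
open AffineAveraging (Site Form1 unitVec unitVec_apply box toSite)
open AffineReproduction (contourSumAdj)
open LatticeForm (quo)
open B12Sec2to5 (l1 l1_nonneg)
open ExpKernelCalculus (MKer Zl BiLoc Decays l1_sub_triangle l1_sub_symm l1_natSmul)
open OneStepResolventKernel (Fib KInv LocStencil proj_zsmul quo_zsmul eq_zsmul_quo_of_proj KInv_inr_inr_coarse)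
open OneStepKernelFamily (KInvStep legSet legW legPt)
open KernelSpecInstance (wH wΦ)
open KKTFluctuationKernel (GamΦ)
open InterLevelTransport (SLam avgLift cwsum cwsum_apply onLat onLat_zsmul onLat_off)
open BalabanStepJets (lamCoeffOf)
open AveragingHessianKernels (ell)
open AveragingHessianKernelsRooted (hessFFAt)
open Summit.QuantumFields.BalabanUV.Beta.SpineRooted (lagrIncAt)
open Summit.QuantumFields.BalabanUV.Beta.HessKerDressedUnits (unitK unitK_apply legScale_inr)
open Summit.QuantumFields.BalabanUV.Beta.SecondOrderUnits (KInvStep_mm_eq_KInv_mm)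
open Summit.QuantumFields.BalabanUV.Beta.GAN24.CombesThomas (SupBound UnitDecayK CauchyDecayK sfStep smStep ConvCKWall)
open Summit.QuantumFields.BalabanUV.Beta.GAN24.E3UnitSplit (e3OfS e3OfS_inl_inr e3OfS_inr e3Lam_unit_split)
open Summit.QuantumFields.BalabanUV.Beta.GAN24.TaylorLamVertexPairing (quo_quo abs_contourSumAdj_le_exp)
open Summit.QuantumFields.BalabanUV.Beta.GAN24.TaylorBlockSum (nonneg_of_dominated)
open Summit.QuantumFields.BalabanUV.Beta.GAN24.StencilSlotE3PhiLeg (phiLeg_three pow_N_eq)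
open Summit.QuantumFields.BalabanUV.Beta.GAN24.TaylorDiffLam (sandwich_const_mul_vertex contourSumAdj_sub
  contourSumAdj_const_mul onLat_sub_apply onLat_const_mul_apply abs_onLat_contourSumAdj_le)
open Summit.QuantumFields.BalabanUV.Beta.GAN24.TaylorRowLam (power_count inv_pow_succ_succ mul_exp_mono_rate l1_le_of_mem_imageY l1_le_of_mem_box)
open Summit.QuantumFields.BalabanUV.Beta.GAN24.TaylorRowLamAt (piece_eq_pref_mul_sandwich)
open Summit.QuantumFields.BalabanUV.Beta.GAN24.SandwichDecimate (decLeg decLeg_apply sandwich_decimate_avgLift_of_legs abs_decLeg_le abs_decLeg_le')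
open Summit.QuantumFields.BalabanUV.Beta.GAN24.KSlotAssembly (convCKWall_holds)
open Summit.QuantumFields.BalabanUV.Beta.GAN24.StencilSlotE3HLeg (legs_three)
open Summit.QuantumFields.BalabanUV.Beta.GAN24.FineReadoutCauchyHolds (exists_wH_cellMean_cauchy)
open Summit.QuantumFields.BalabanUV.Beta.GAN24.FineReadoutCauchyDecLegs (decLegs_three_of_cellMean)
open Summit.QuantumFields.BalabanUV.Beta.GAN24.S3DiffL (phiDiff_of_cauchyDecayK key_count pref_succ_mul)
open Summit.QuantumFields.BalabanUV.Beta.GAN24.S3DiffLAt (abs_pref_sandwich_sub_le piece_succ_eq_pref_mul_sandwich)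

namespace Summit.QuantumFields.BalabanUV.Beta.GAN24.S3DiffLAt

variable {d : ℕ} {Lc : ℕ} [NeZero Lc]

/-! ## §5-ρ Row R3-dL AT THE IN-BLOCK ROOT: the depth-paired rooted Λ differences from the legs (generic `d`), and at `d = 3` -/

section Row

/-- [folklore] **ROW R3-dL AT THE IN-BLOCK ROOT, FROM THE LEGS** (generic `d`; ONE `eL` for ALL roots `r ∈ box (d+1) Lc`, written before `∀ r`): GIVEN, for every member, the two outer legs and the top multiplier leg in
`legs_three`∕`phiLeg_three` currency (`hN1`, `hG`, `hΦ`), the one-step difference of the unit-normalised multiplier legs (`hdΦ`, the K-slot's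
`CauchyDecayK` — `phiDiff_of_cauchyDecayK`) and the one-step differences of the `Lc`-DECIMATED minimiser legs (`hdN1`, `hdG` — «(N1-Cauchy)» in
leaf-19's `FineReadoutCauchyDecLegs.decLegs_three_of_cellMean` currency), the depth-paired difference of the Λ increments (member `n+3`, level `m+2`
vs member `n+2`, level `m+1`, both pushed `n−m` times) is at most `eL·(max θC θK)^{n+1}·(Lc⁻¹)^{n−m}` with ONE `eL` free of `(n, m)`. -/
theorem diffL_of_legs (cΛ : ℝ) {κ CH CΦ dC dK θC θK : ℝ} (hκ : 0 < κ) (hCH : 0 ≤ CH) (hCΦ : 0 ≤ CΦ) (hdC : 0 ≤ dC) (hdK : 0 ≤ dK)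
    (hθC : 0 ≤ θC) (hθK : 0 ≤ θK)
    (hN1 : ∀ (j : ℕ) (κ₁ l : Fin (d + 1)) (z : Site (d + 1)),
      |((Lc : ℝ) ^ (j + 1)) ^ (d + 2) * wH (N := Lc ^ (j + 1)) κ₁ l z| ≤ CH * Real.exp (-κ * l1 (quo (Lc ^ (j + 1)) z)))
    (hG : ∀ (j : ℕ) (α l : Fin (d + 1)) (x' w : Site (d + 1)),
      |((Lc : ℝ) ^ (j + 1)) ^ (d + 2) * GamΦ (N := Lc ^ (j + 1)) α x' l w| ≤
        CH * Real.exp (-κ * l1 (x' - quo (Lc ^ (j + 1)) w)))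
    (hΦ : ∀ (j : ℕ) (κ₁ l : Fin (d + 1)) (y : Site (d + 1)),
      |((Lc : ℝ) ^ (j + 1)) ^ (2 * (d + 1)) * wΦ (N := Lc ^ (j + 1)) κ₁ l y| ≤ CΦ * Real.exp (-κ * l1 y))
    (hdΦ : ∀ (n : ℕ) (κ₁ l : Fin (d + 1)) (y : Site (d + 1)),
      |((Lc : ℝ) ^ (n + 1 + 1 + 1)) ^ (2 * (d + 1)) * wΦ (N := Lc ^ (n + 1 + 1 + 1)) κ₁ l y -
          ((Lc : ℝ) ^ (n + 1 + 1)) ^ (2 * (d + 1)) * wΦ (N := Lc ^ (n + 1 + 1)) κ₁ l y| ≤ dK * θK ^ (n + 1) * Real.exp (-κ * l1 y))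
    (hdN1 : ∀ (n : ℕ) (k l : Fin (d + 1)) (u u' : Site (d + 1)),
      |(∑ i ∈ legSet d Lc (Sum.inl k), legW d Lc (Sum.inl k) *
          (((Lc : ℝ) ^ (n + 1 + 1 + 1)) ^ (d + 2) *
            wH (N := Lc ^ (n + 1 + 1 + 1)) k l (legPt Lc (Sum.inl k) u i - ((Lc ^ (n + 1 + 1 + 1) : ℕ) : ℤ) • u'))) -
        ((Lc : ℝ) ^ (n + 1 + 1)) ^ (d + 2) * wH (N := Lc ^ (n + 1 + 1)) k l (u - ((Lc ^ (n + 1 + 1) : ℕ) : ℤ) • u')| ≤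
        dC * θC ^ (n + 1) * Real.exp (-κ * l1 (quo (Lc ^ (n + 1 + 1)) u - u')))
    (hdG : ∀ (n : ℕ) (α l : Fin (d + 1)) (x' w : Site (d + 1)),
      |(∑ i ∈ legSet d Lc (Sum.inl l), legW d Lc (Sum.inl l) *
          (((Lc : ℝ) ^ (n + 1 + 1 + 1)) ^ (d + 2) * GamΦ (N := Lc ^ (n + 1 + 1 + 1)) α x' l (legPt Lc (Sum.inl l) w i))) -
        ((Lc : ℝ) ^ (n + 1 + 1)) ^ (d + 2) * GamΦ (N := Lc ^ (n + 1 + 1)) α x' l w| ≤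
        dC * θC ^ (n + 1) * Real.exp (-κ * l1 (x' - quo (Lc ^ (n + 1 + 1)) w))) :
    ∃ eL : ℝ, ∀ (r : Fin (d + 1) → ℕ), r ∈ box (d + 1) Lc → ∀ n m : ℕ, m < n → ∀ (κ' : Fin (d + 1)) (u' x' z' : Site (d + 1)) (a b : Fib d),
      |((Lc : ℝ) ^ (n + 1 + 1 + 1)) ^ (2 * (d + 1)) * e3OfS (Lc ^ (n + 1 + 1 + 1))
          (fun κ u => ((((Lc : ℝ) ^ (d + 1)) ^ (n - m) * (cΛ * ((Lc : ℝ) ^ (m + 1 + 1)) ^ (2 * d + 4))) •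
            lagrIncAt d (toSite r) Lc (Lc ^ (m + 1 + 1)) (Lc ^ (m + 1 + 1 + 1)) κ u)) κ' u' x' z' a b -
        ((Lc : ℝ) ^ (n + 1 + 1)) ^ (2 * (d + 1)) * e3OfS (Lc ^ (n + 1 + 1))
          (fun κ u => ((((Lc : ℝ) ^ (d + 1)) ^ (n - m) * (cΛ * ((Lc : ℝ) ^ (m + 1)) ^ (2 * d + 4))) •
            lagrIncAt d (toSite r) Lc (Lc ^ (m + 1)) (Lc ^ (m + 1 + 1)) κ u)) κ' u' x' z' a b| ≤
        eL * (max θC θK) ^ (n + 1) * ((Lc : ℝ)⁻¹) ^ (n - m) := by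
  have hL0 : (0 : ℝ) < Lc := by exact_mod_cast Nat.pos_of_ne_zero (NeZero.ne Lc)
  have hZl : 0 ≤ Zl (d + 1) (κ / 2) := by unfold ExpKernelCalculus.Zl; exact tsum_nonneg fun _ => (Real.exp_pos _).le
  set θ : ℝ := max θC θK with hθ
  have hθ0 : 0 ≤ θ := hθC.trans (le_max_left _ _)
  set Q₀ : ℝ := dC * (CH * Real.exp κ) * CΦ + CH * (CH * Real.exp κ) * dK + CH * dC * CΦ with hQ₀
  set BOX : ℝ := (((8 * (d + 1) * (Lc + 1) + 1 : ℕ) : ℝ) ^ (d + 1)) * (((d : ℝ) + 1) * (((d : ℝ) + 1) *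
      ((((2 * (4 * (d + 1) + 1) + 1) ^ (d + 1) : ℕ) : ℝ) * (2 * (ell (d + 1) Lc : ℝ) ^ 2)))) with hBOX
  set KWU : ℝ := Real.exp (κ * (((d : ℝ) + 1) * (4 * ((d : ℝ) + 1) * (Lc + 1)) + (d + 1))) *
      Real.exp (κ * (((d : ℝ) + 1) * ((4 * ((d : ℝ) + 1) + 1) + 1) + (d + 1))) with hKWU
  set Z : ℝ := Zl (d + 1) (κ / 2) with hZ
  refine ⟨|cΛ| / (Lc : ℝ) ^ (d + 1) * (((d : ℝ) + 1) * (Q₀ * Real.exp κ * BOX * KWU) * Z) * ((Lc : ℝ) ^ 2)⁻¹,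
    fun r hr n m hmn κ' u' x' z' a b => ?_⟩
  have hRHS : 0 ≤ |cΛ| / (Lc : ℝ) ^ (d + 1) * (((d : ℝ) + 1) * (Q₀ * Real.exp κ * BOX * KWU) * Z) * ((Lc : ℝ) ^ 2)⁻¹ *
      θ ^ (n + 1) * ((Lc : ℝ)⁻¹) ^ (n - m) := by positivity
  -- the zero blocks
  rcases a with α | ν
  swap
  · rw [e3OfS_inr, e3OfS_inr, mul_zero, mul_zero, sub_zero, abs_zero]; exact hRHS
  rcases b with β | ν'
  swap
  · rw [e3OfS_inl_inr, e3OfS_inl_inr, mul_zero, mul_zero, sub_zero, abs_zero]; exact hRHS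
  -- indices: member `p = n+2`, level `ℓ = m+1`, depth `k = n−m`
  set p : ℕ := n + 1 + 1 with hpdef
  have hp : p = (m + 1) + (n - m) + 1 := by omega
  haveI hN0 : NeZero (Lc ^ p) := ⟨pow_ne_zero _ (NeZero.ne Lc)⟩
  haveI hNq0 : NeZero (Lc ^ (p + 1)) := ⟨pow_ne_zero _ (NeZero.ne Lc)⟩
  have hcast : (((Lc ^ p : ℕ) : ℝ)) = (Lc : ℝ) ^ p := by push_cast; rfl
  have hcastq : (((Lc ^ (p + 1) : ℕ) : ℝ)) = (Lc : ℝ) ^ (p + 1) := by push_cast; rfl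
  have epq : Lc * Lc ^ p = Lc ^ (p + 1) := (pow_succ' Lc p).symm
  -- the two pieces as prefactor × aligned sandwiches
  rw [piece_succ_eq_pref_mul_sandwich hr cΛ (m + 1) (n - m) p hp hκ hCΦ (hG p) (hN1 p) (hΦ p) κ' u' x' z' α β,
    piece_eq_pref_mul_sandwich hr cΛ (m + 1) (n - m) p hp κ' u' x' z' α β]
  -- the legs of member `p`
  have hA : ∀ (l : Fin (d + 1)) (w : Site (d + 1)),
      |((Lc ^ p : ℕ) : ℝ) ^ (d + 2) * GamΦ (N := Lc ^ p) α x' l w| ≤ CH * Real.exp (-κ * l1 (x' - quo (Lc ^ p) w)) :=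
    fun l w => by rw [hcast]; exact hG (n + 1) α l x' w
  have hB : ∀ (l' : Fin (d + 1)) (y : Site (d + 1)),
      |((Lc ^ p : ℕ) : ℝ) ^ (d + 2) * wH (N := Lc ^ p) l' β (y - ((Lc ^ p : ℕ) : ℤ) • z')| ≤
        CH * Real.exp (-κ * l1 (quo (Lc ^ p) y - z')) := fun l' y => by
    have hq : quo (Lc ^ p) (y - ((Lc ^ p : ℕ) : ℤ) • z') = quo (Lc ^ p) y - z' := by
      rw [sub_eq_add_neg y, ← smul_neg, BlochFibreUniqueness.quo_add_zsmul, ← sub_eq_add_neg]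
    rw [hcast, ← hq]
    exact hN1 (n + 1) l' β _
  -- the decimated legs of member `p+1` (leaf-04-g20's transfer)
  have hAq : ∀ (l : Fin (d + 1)) (w : Site (d + 1)),
      |((Lc ^ (p + 1) : ℕ) : ℝ) ^ (d + 2) * GamΦ (N := Lc ^ (p + 1)) α x' l w| ≤ CH * Real.exp (-κ * l1 (x' - quo (Lc * Lc ^ p) w)) :=
    fun l w => by rw [hcastq, epq]; exact hG (p) α l x' w
  have hBq : ∀ (l' : Fin (d + 1)) (y : Site (d + 1)),
      |((Lc ^ (p + 1) : ℕ) : ℝ) ^ (d + 2) * wH (N := Lc ^ (p + 1)) l' β (y - ((Lc ^ (p + 1) : ℕ) : ℤ) • z')| ≤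
        CH * Real.exp (-κ * l1 (quo (Lc * Lc ^ p) y - z')) := fun l' y => by
    have hq : quo (Lc ^ (p + 1)) (y - ((Lc ^ (p + 1) : ℕ) : ℤ) • z') = quo (Lc ^ (p + 1)) y - z' := by
      rw [sub_eq_add_neg y, ← smul_neg, BlochFibreUniqueness.quo_add_zsmul, ← sub_eq_add_neg]
    rw [hcastq, epq, ← hq]
    exact hN1 p l' β _
  have hA' := abs_decLeg_le Lc (Lc ^ p) hκ.le x' hAq
  have hB' := abs_decLeg_le' Lc (Lc ^ p) hκ.le z' hBq
  -- the differenced outer legs («(N1-Cauchy)»-dec)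
  have hdA : ∀ (l : Fin (d + 1)) (w : Site (d + 1)),
      |decLeg Lc (fun l w => (((Lc ^ (p + 1) : ℕ) : ℝ)) ^ (d + 2) * GamΦ (N := Lc ^ (p + 1)) α x' l w) l w -
          (((Lc ^ p : ℕ) : ℝ)) ^ (d + 2) * GamΦ (N := Lc ^ p) α x' l w| ≤
        dC * θC ^ (n + 1) * Real.exp (-κ * l1 (x' - quo (Lc ^ p) w)) := fun l w => by
    simp only [decLeg_apply, hcast, hcastq]
    exact hdG n α l x' w
  have hdB : ∀ (l' : Fin (d + 1)) (y : Site (d + 1)),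
      |decLeg Lc (fun l' y => (((Lc ^ (p + 1) : ℕ) : ℝ)) ^ (d + 2) * wH (N := Lc ^ (p + 1)) l' β (y - ((Lc ^ (p + 1) : ℕ) : ℤ) • z')) l' y -
          (((Lc ^ p : ℕ) : ℝ)) ^ (d + 2) * wH (N := Lc ^ p) l' β (y - ((Lc ^ p : ℕ) : ℤ) • z')| ≤
        dC * θC ^ (n + 1) * Real.exp (-κ * l1 (quo (Lc ^ p) y - z')) := fun l' y => by
    simp only [decLeg_apply, hcast, hcastq]
    exact hdN1 n l' β y z'
  -- the three-leg bound
  have hmain := abs_pref_sandwich_sub_le (d := d) (Lc := Lc) (u' := u')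
    (A := fun l w => (((Lc ^ p : ℕ) : ℝ)) ^ (d + 2) * GamΦ (N := Lc ^ p) α x' l w)
    (A' := decLeg Lc (fun l w => (((Lc ^ (p + 1) : ℕ) : ℝ)) ^ (d + 2) * GamΦ (N := Lc ^ (p + 1)) α x' l w))
    (B := fun l' y => (((Lc ^ p : ℕ) : ℝ)) ^ (d + 2) * wH (N := Lc ^ p) l' β (y - ((Lc ^ p : ℕ) : ℤ) • z'))
    (B' := decLeg Lc (fun l' y => (((Lc ^ (p + 1) : ℕ) : ℝ)) ^ (d + 2) * wH (N := Lc ^ (p + 1)) l' β (y - ((Lc ^ (p + 1) : ℕ) : ℤ) • z')))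
    hr cΛ (m + 1) (n - m) p hp hκ hCΦ (by positivity : 0 ≤ dK * θK ^ (n + 1)) hA hB hA' hB' hdA hdB (hΦ (n + 1)) (hΦ p) (hdΦ n) κ'
  rw [← hBOX, ← hKWU, ← hZ] at hmain
  refine hmain.trans ?_
  -- weaken the rates to `θ = max θC θK`, drop the exponential, display `(Lc^{k+2})⁻¹ = (Lc²)⁻¹·(Lc⁻¹)^k`
  have hE : Real.exp (-(κ / 2) * (l1 (x' - u') + l1 (z' - u'))) ≤ 1 := by
    rw [Real.exp_le_one_iff]
    nlinarith [l1_nonneg (x' - u'), l1_nonneg (z' - u'), hκ]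
  have hθCle : θC ^ (n + 1) ≤ θ ^ (n + 1) := pow_le_pow_left₀ hθC (le_max_left _ _) _
  have hθKle : θK ^ (n + 1) ≤ θ ^ (n + 1) := pow_le_pow_left₀ hθK (le_max_right _ _) _
  have hQ : dC * θC ^ (n + 1) * (CH * Real.exp κ) * CΦ + CH * (CH * Real.exp κ) * (dK * θK ^ (n + 1)) +
      CH * (dC * θC ^ (n + 1)) * CΦ ≤ θ ^ (n + 1) * Q₀ := by
    rw [hQ₀]
    have e : θ ^ (n + 1) * (dC * (CH * Real.exp κ) * CΦ + CH * (CH * Real.exp κ) * dK + CH * dC * CΦ) =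
        dC * θ ^ (n + 1) * (CH * Real.exp κ) * CΦ + CH * (CH * Real.exp κ) * (dK * θ ^ (n + 1)) +
          CH * (dC * θ ^ (n + 1)) * CΦ := by ring
    rw [e]
    gcongr
  rw [inv_pow_succ_succ]
  calc |cΛ| / (Lc : ℝ) ^ (d + 1) *
        (((d : ℝ) + 1) * ((dC * θC ^ (n + 1) * (CH * Real.exp κ) * CΦ + CH * (CH * Real.exp κ) * (dK * θK ^ (n + 1)) +
          CH * (dC * θC ^ (n + 1)) * CΦ) * Real.exp κ * BOX * KWU) * Z) *
        (((Lc : ℝ) ^ 2)⁻¹ * ((Lc : ℝ)⁻¹) ^ (n - m)) * Real.exp (-(κ / 2) * (l1 (x' - u') + l1 (z' - u')))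
      ≤ |cΛ| / (Lc : ℝ) ^ (d + 1) * (((d : ℝ) + 1) * ((θ ^ (n + 1) * Q₀) * Real.exp κ * BOX * KWU) * Z) *
        (((Lc : ℝ) ^ 2)⁻¹ * ((Lc : ℝ)⁻¹) ^ (n - m)) * 1 := by gcongr
    _ = _ := by ring

/-- **ROW R3-dL AT THE IN-BLOCK ROOT, `d = 3`, MODULO THE CELL-MEAN «(N1-Cauchy)» (hypothesis `hC`, N1-CAUCHY-SPEC §1 VERBATIM, and
its decimated-leg consequences `hdN1`∕`hdG` = the two conjuncts of leaf-19's `FineReadoutCauchyDecLegs.decLegs_three_of_cellMean hLc … hC`)**: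
the hypothesis `dL` of the owner's END `StencilSlotE3RateOfPieces.e3SupRate_of_pieces` ∕ the `dL` binder of `StencilSlotRowsMerge.hS_hSall_of_rows_indep`
∕ the typer's `S3.DiffL 3 Lc cΛ eL θ ρ` VERBATIM with the row's OWN `θ = max θC θK` (θC the (N1-Cauchy) rate, θK the K-slot's `CauchyDecayK` rate from
`KSlotAssembly.convCKWall_holds`) and `ρ = Lc⁻¹`; the undifferenced legs from `StencilSlotE3HLeg.legs_three` ((N1) inside) and
`StencilSlotE3PhiLeg.phiLeg_three` (the K-slot inside).  [folklore]∕NOT IN PRINT; one hypothesis of `e3SupRate_of_pieces`; discharges NOTHING of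
(hS, hSall) by itself; records-grade (rule (k)) until the cell-MEAN «(N1-Cauchy)» is a tree theorem; NOT BetaPertH, NOT continuum, NOT Clay. -/
theorem diffL_three_of_decLegs (hLc : 2 ≤ Lc) (cΛ : ℝ) {dC θC κC : ℝ} (hdC : 0 ≤ dC) (hθC0 : 0 ≤ θC) (hθC1 : θC < 1) (hκC : 0 < κC)
    (hdN1 : ∀ (n : ℕ) (k l : Fin (3 + 1)) (u u' : Fin (3 + 1) → ℤ),
      |(∑ i ∈ legSet 3 Lc (Sum.inl k), legW 3 Lc (Sum.inl k) *
          (((Lc : ℝ) ^ (n + 1 + 1 + 1)) ^ (3 + 2) *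
            wH (N := Lc ^ (n + 1 + 1 + 1)) k l (legPt Lc (Sum.inl k) u i - ((Lc ^ (n + 1 + 1 + 1) : ℕ) : ℤ) • u'))) -
        ((Lc : ℝ) ^ (n + 1 + 1)) ^ (3 + 2) * wH (N := Lc ^ (n + 1 + 1)) k l (u - ((Lc ^ (n + 1 + 1) : ℕ) : ℤ) • u')| ≤
        dC * θC ^ (n + 1) * Real.exp (-κC * l1 (quo (Lc ^ (n + 1 + 1)) u - u')))
    (hdG : ∀ (n : ℕ) (α l : Fin (3 + 1)) (x' w : Fin (3 + 1) → ℤ),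
      |(∑ i ∈ legSet 3 Lc (Sum.inl l), legW 3 Lc (Sum.inl l) *
          (((Lc : ℝ) ^ (n + 1 + 1 + 1)) ^ (3 + 2) * GamΦ (N := Lc ^ (n + 1 + 1 + 1)) α x' l (legPt Lc (Sum.inl l) w i))) -
        ((Lc : ℝ) ^ (n + 1 + 1)) ^ (3 + 2) * GamΦ (N := Lc ^ (n + 1 + 1)) α x' l w| ≤
        dC * θC ^ (n + 1) * Real.exp (-κC * l1 (x' - quo (Lc ^ (n + 1 + 1)) w))) :
    ∃ eL θ ρ : ℝ, 0 ≤ θ ∧ θ < 1 ∧ 0 ≤ ρ ∧ ρ < 1 ∧ ∀ (r : Fin (3 + 1) → ℕ), r ∈ box (3 + 1) Lc →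
      ∀ (n m : ℕ), m < n → ∀ (κ' : Fin (3 + 1)) (u' : Fin (3 + 1) → ℤ), SupBound (fun x z a b =>
      ((Lc : ℝ) ^ (n + 1 + 1 + 1)) ^ (2 * (3 + 1)) * e3OfS (Lc ^ (n + 1 + 1 + 1)) (fun κ u => ((((Lc : ℝ) ^ (3 + 1)) ^ (n - m) * (cΛ * ((Lc : ℝ) ^ (m + 1 + 1)) ^ (2 * 3 + 4))) •
        lagrIncAt 3 (toSite r) Lc (Lc ^ (m + 1 + 1)) (Lc ^ (m + 1 + 1 + 1)) κ u)) κ' u' x z a b -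
      ((Lc : ℝ) ^ (n + 1 + 1)) ^ (2 * (3 + 1)) * e3OfS (Lc ^ (n + 1 + 1)) (fun κ u => ((((Lc : ℝ) ^ (3 + 1)) ^ (n - m) * (cΛ * ((Lc : ℝ) ^ (m + 1)) ^ (2 * 3 + 4))) •
        lagrIncAt 3 (toSite r) Lc (Lc ^ (m + 1)) (Lc ^ (m + 1 + 1)) κ u)) κ' u' x z a b) (eL * θ ^ (n + 1) * ρ ^ (n - m)) := by
  have hL0 : (0 : ℝ) < Lc := by exact_mod_cast Nat.pos_of_ne_zero (NeZero.ne Lc)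
  have hL2 : (2 : ℝ) ≤ Lc := by exact_mod_cast hLc
  -- the undifferenced legs ((N1) and the K-slot, tree theorems) and the K-slot's one-step rate
  obtain ⟨CH, κ₁, hκ₁, hCH, hH, hG⟩ := legs_three (Lc := Lc)
  obtain ⟨CΦ, δ₁, hδ₁, hCΦ, hΦ1, -⟩ := phiLeg_three (Lc := Lc)
  obtain ⟨CK, δK, cK, θK, hδK, hθK0, hθK1, -, hKC⟩ := convCKWall_holds (Lc := Lc) hLc
  -- one common rate
  set ρ₀ : ℝ := min (min κ₁ δ₁) (min κC δK) with hρ₀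
  have hρ0 : 0 < ρ₀ := lt_min (lt_min hκ₁ hδ₁) (lt_min hκC hδK)
  have hρκ₁ : ρ₀ ≤ κ₁ := (min_le_left _ _).trans (min_le_left _ _)
  have hρδ₁ : ρ₀ ≤ δ₁ := (min_le_left _ _).trans (min_le_right _ _)
  have hρκC : ρ₀ ≤ κC := (min_le_right _ _).trans (min_le_left _ _)
  have hρδK : ρ₀ ≤ δK := (min_le_right _ _).trans (min_le_right _ _)
  have hcKθ : ∀ j : ℕ, 0 ≤ cK * θK ^ j := fun j =>
    (mul_nonneg_iff_of_pos_left (by positivity : (0 : ℝ) < (Lc : ℝ) ^ (2 * (3 + 1)))).1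
      (nonneg_of_dominated (Real.exp_pos _) (phiDiff_of_cauchyDecayK (d := 3) hKC hδK.le j 0 0 0))
  have hcK : 0 ≤ cK := by simpa using hcKθ 0
  have hN1 : ∀ (j : ℕ) (κ₂ l : Fin (3 + 1)) (z : Site (3 + 1)),
      |((Lc : ℝ) ^ (j + 1)) ^ (3 + 2) * wH (N := Lc ^ (j + 1)) κ₂ l z| ≤ CH * Real.exp (-ρ₀ * l1 (quo (Lc ^ (j + 1)) z)) := by
    intro j κ₂ l z
    have h := hH j κ₂ l z 0
    rw [smul_zero, sub_zero, sub_zero] at h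
    exact h.trans (mul_exp_mono_rate hCH hρκ₁ (l1_nonneg _))
  have hG' : ∀ (j : ℕ) (α l : Fin (3 + 1)) (x' w : Site (3 + 1)),
      |((Lc : ℝ) ^ (j + 1)) ^ (3 + 2) * GamΦ (N := Lc ^ (j + 1)) α x' l w| ≤
        CH * Real.exp (-ρ₀ * l1 (x' - quo (Lc ^ (j + 1)) w)) := fun j α l x' w =>
    (hG j α l x' w).trans (mul_exp_mono_rate hCH hρκ₁ (l1_nonneg _))
  have hΦ : ∀ (j : ℕ) (κ₂ l : Fin (3 + 1)) (y : Site (3 + 1)),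
      |((Lc : ℝ) ^ (j + 1)) ^ (2 * (3 + 1)) * wΦ (N := Lc ^ (j + 1)) κ₂ l y| ≤ CΦ * Real.exp (-ρ₀ * l1 y) := by
    intro j κ₂ l y
    haveI : NeZero (Lc ^ (j + 1)) := ⟨pow_ne_zero _ (NeZero.ne Lc)⟩
    have h := hΦ1 j y (((Lc ^ (j + 1) : ℕ) : ℤ) • (0 : Site (3 + 1))) κ₂ l
    rw [KInv_inr_inr_coarse, quo_zsmul, sub_zero] at h
    exact h.trans (mul_exp_mono_rate hCΦ hρδ₁ (l1_nonneg _))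
  have hdΦ : ∀ (n : ℕ) (κ₂ l : Fin (3 + 1)) (y : Site (3 + 1)),
      |((Lc : ℝ) ^ (n + 1 + 1 + 1)) ^ (2 * (3 + 1)) * wΦ (N := Lc ^ (n + 1 + 1 + 1)) κ₂ l y -
          ((Lc : ℝ) ^ (n + 1 + 1)) ^ (2 * (3 + 1)) * wΦ (N := Lc ^ (n + 1 + 1)) κ₂ l y| ≤
        ((Lc : ℝ) ^ (2 * (3 + 1)) * cK) * θK ^ (n + 1) * Real.exp (-ρ₀ * l1 y) := by
    intro n κ₂ l y
    have h := phiDiff_of_cauchyDecayK (d := 3) hKC hδK.le (n + 1) κ₂ l y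
    refine (h.trans (mul_exp_mono_rate (by positivity : 0 ≤ (Lc : ℝ) ^ (2 * (3 + 1)) * (cK * θK ^ (n + 1))) hρδK
      (l1_nonneg _))).trans (le_of_eq ?_)
    ring
  have hdN1' : ∀ (n : ℕ) (k l : Fin (3 + 1)) (u u' : Fin (3 + 1) → ℤ),
      |(∑ i ∈ legSet 3 Lc (Sum.inl k), legW 3 Lc (Sum.inl k) *
          (((Lc : ℝ) ^ (n + 1 + 1 + 1)) ^ (3 + 2) *
            wH (N := Lc ^ (n + 1 + 1 + 1)) k l (legPt Lc (Sum.inl k) u i - ((Lc ^ (n + 1 + 1 + 1) : ℕ) : ℤ) • u'))) -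
        ((Lc : ℝ) ^ (n + 1 + 1)) ^ (3 + 2) * wH (N := Lc ^ (n + 1 + 1)) k l (u - ((Lc ^ (n + 1 + 1) : ℕ) : ℤ) • u')| ≤
        (dC * θC ^ (n + 1)) * Real.exp (-ρ₀ * l1 (quo (Lc ^ (n + 1 + 1)) u - u')) := fun n k l u u' =>
    (hdN1 n k l u u').trans (mul_exp_mono_rate (by positivity) hρκC (l1_nonneg _))
  have hdG' : ∀ (n : ℕ) (α l : Fin (3 + 1)) (x' w : Fin (3 + 1) → ℤ),
      |(∑ i ∈ legSet 3 Lc (Sum.inl l), legW 3 Lc (Sum.inl l) *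
          (((Lc : ℝ) ^ (n + 1 + 1 + 1)) ^ (3 + 2) * GamΦ (N := Lc ^ (n + 1 + 1 + 1)) α x' l (legPt Lc (Sum.inl l) w i))) -
        ((Lc : ℝ) ^ (n + 1 + 1)) ^ (3 + 2) * GamΦ (N := Lc ^ (n + 1 + 1)) α x' l w| ≤
        (dC * θC ^ (n + 1)) * Real.exp (-ρ₀ * l1 (x' - quo (Lc ^ (n + 1 + 1)) w)) := fun n α l x' w =>
    (hdG n α l x' w).trans (mul_exp_mono_rate (by positivity) hρκC (l1_nonneg _))
  obtain ⟨eL, heL⟩ := diffL_of_legs (d := 3) (Lc := Lc) cΛ hρ0 hCH hCΦ hdC (by positivity : 0 ≤ (Lc : ℝ) ^ (2 * (3 + 1)) * cK)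
    hθC0 hθK0 hN1 hG' hΦ hdΦ hdN1' hdG'
  refine ⟨eL, max θC θK, (Lc : ℝ)⁻¹, hθC0.trans (le_max_left _ _), max_lt hθC1 hθK1, inv_nonneg.2 hL0.le,
    inv_lt_one_of_one_lt₀ (by linarith), fun r hr n m hmn κ' u' x z a b => heL r hr n m hmn κ' u' x z a b⟩


/-- **ROW R3-dL AT EVERY IN-BLOCK ROOT, UNCONDITIONALLY AT `d = 3`, `Lc ≥ 2` — THE UNDRESSED TOP-ALIGNED PAIR LETTER (births `i ≥ 1`, lengths `≥ 2`) OF `GAN24/BornLambdaDriftSup`'s socket in road S3's units**: the hypothesis `dL` of `StencilSlotE3RateOfPieces.e3SupRate_of_pieces`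
∕ the `dL` binder of `StencilSlotRowsMerge.hS_hSall_of_rows_indep` and `StencilSlotSAllThree.hS_hSall_three_of_diffRows` ∕ `S3.DiffL 3 Lc cΛ eL θ ρ`,
VERBATIM (∃-packaged, the row's own `θ`, `ρ`), from TREE theorems only: «(N1-Cauchy)» = `FineReadoutCauchyHolds.exists_wH_cellMean_cauchy`
(leaf-17-g11's team END) through `FineReadoutCauchyDecLegs.decLegs_three_of_cellMean` (leaf-19-g15), the K-slot's `CauchyDecayK`
(`KSlotAssembly.convCKWall_holds`), (N1) (`StencilSlotE3HLeg.legs_three`), the alignment «SANDWICH-DECIMATE*» (leaf-04-g20).  [folklore]∕NOT IN PRINT —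
our proof; ONE of twelve per-piece estimates; discharges NOTHING of (hS, hSall) by itself; NOT BetaPertH, NOT continuum, NOT Clay. -/
theorem diffL_three_at (hLc : 2 ≤ Lc) (cΛ : ℝ) :
    ∃ eL θ ρ : ℝ, 0 ≤ θ ∧ θ < 1 ∧ 0 ≤ ρ ∧ ρ < 1 ∧ ∀ (r : Fin (3 + 1) → ℕ), r ∈ box (3 + 1) Lc →
      ∀ (n m : ℕ), m < n → ∀ (κ' : Fin (3 + 1)) (u' : Fin (3 + 1) → ℤ), SupBound (fun x z a b =>
      ((Lc : ℝ) ^ (n + 1 + 1 + 1)) ^ (2 * (3 + 1)) * e3OfS (Lc ^ (n + 1 + 1 + 1)) (fun κ u => ((((Lc : ℝ) ^ (3 + 1)) ^ (n - m) * (cΛ * ((Lc : ℝ) ^ (m + 1 + 1)) ^ (2 * 3 + 4))) •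
        lagrIncAt 3 (toSite r) Lc (Lc ^ (m + 1 + 1)) (Lc ^ (m + 1 + 1 + 1)) κ u)) κ' u' x z a b -
      ((Lc : ℝ) ^ (n + 1 + 1)) ^ (2 * (3 + 1)) * e3OfS (Lc ^ (n + 1 + 1)) (fun κ u => ((((Lc : ℝ) ^ (3 + 1)) ^ (n - m) * (cΛ * ((Lc : ℝ) ^ (m + 1)) ^ (2 * 3 + 4))) •
        lagrIncAt 3 (toSite r) Lc (Lc ^ (m + 1)) (Lc ^ (m + 1 + 1)) κ u)) κ' u' x z a b) (eL * θ ^ (n + 1) * ρ ^ (n - m)) := by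
  obtain ⟨c, θ, κ₁, hc, hθ0, hθ1, hκ₁, hC⟩ := exists_wH_cellMean_cauchy Lc hLc
  obtain ⟨c', θ', κ', hc', hθ'0, hθ'1, hκ', hD1, hD2⟩ := decLegs_three_of_cellMean (Lc := Lc) hLc hc hθ0 hθ1 hκ₁ hC
  exact diffL_three_of_decLegs hLc cΛ hc' hθ'0 hθ'1 hκ' hD1 hD2

end Row

end Summit.QuantumFields.BalabanUV.Beta.GAN24.S3DiffLAt

end
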